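import Summits.Ventures.Crystal3D.Theorems.StickyWulffConstantGenericWallFloorStackWalkInjective
import HarnessLib

/-!
# The stack walk with a TILTED vertical: `e₃`-monotonicity, bounded drift, and injectivity of `top ↦ end state`
# over an `e₃`-window (crux `GenericWallFloor`, stmt-Ventures-19480, line `WallLedgerG`)

HONEST FRAMING. Part of the venture `Summits/Ventures/Crystal3D` (cell `crystal3d-full`), helper `--supports` the
crux `GenericWallFloor` of `route-Ventures-StickyWulffConstant`, REGISTERED line `WallLedgerG`, open stub
`stub_twoSlabAdhesion` (general fillings).  Rung credit only; F-C1 not moved; NOT the stub.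

The stack walk (`…StackWalkDefs`, `…StackWalk`) and its injectivity (`…StackWalkInjective`) are stated for an ABSTRACT
unit vertical `z`: the bottom slot must be steep for `z` (`⟪A u, z⟫ ≥ √2/2`), every step rises by `≥ 3/8` in `z`,
and the displacement stays in the cone `‖Δ‖ ≤ (8/3)⟪Δ, z⟫`.  The stack LEDGERS, however, take `z = e₃`, and the
injectivity theorem `walkRun_start_injective` describes the sealed sample window by `z`-heights — which for a tilted
`z` is a tilted slab and does not fit inside the clamped sample.  This file supplies what a ledger with a TILTED
vertical needs:

* `inner_e3_ge_of_tilt` — if `‖z − e₃‖ ≤ 1/4` then every unit step with `⟪d, z⟫ ≥ 3/8` rises by `≥ 1/8` in `e₃`,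
  and a `z`-steep slot rises by `≥ 9/20` in `e₃`;
* `walkRun_disp_le_of_tilt` — along a run, `0 ≤ Δ₂` and `‖Δ‖ ≤ 8·Δ₂` for the displacement `Δ` from the start
  (the cone bound plus `‖z − e₃‖ ≤ 1/4`); `walkRun_height3_mono` — `e₃`-heights never decrease;
* `walkRun_deep_prefix_tilt`, `walkRun_ne_start_tilt`, **`walkRun_start_injective_tilt`** — the §Grain results of
  `…StackWalkInjective` with the sample window described by `e₃`-HEIGHTS (`hlo ≤ p₂ ≤ Hd`) while the walk runs with
  the tilted vertical `z`.

Consequence (next file `…StackLedgerOneSidedTilt`): the one-sided stack ledger holds for every slot that is steep for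
SOME unit `z` with `‖z − e₃‖ ≤ 1/4`, i.e. for every slot whose `e₃`-component is `≥ 0.51` (was `0.707`) — in particular
for the steepest IN-PLANE slot of a composition plane tilted by `θ` as soon as `(√3/2) sin θ ≥ 0.51`.
WHAT THIS IS NOT: not the stub; no ledger here; F-C1 not moved.
-/

noncomputable section

namespace Summit.Ventures.Crystal3D.Theorems

open Finset
open Literature.MathematicalPhysics.StatisticalMechanics (fccStacking)
open scoped InnerProductSpace

variable {X : Finset (EuclideanSpace ℝ (Fin 3))}

/-! ### Tilt arithmetic -/

/-- **Tilt transfer.**  If `‖z − e₃‖ ≤ 1/4` then `⟪d, e₃⟫ ≥ ⟪d, z⟫ − ‖d‖/4`. -/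
theorem inner_e3_ge_of_tilt {z : EuclideanSpace ℝ (Fin 3)}
    (hze : ‖z - EuclideanSpace.single (2 : Fin 3) (1 : ℝ)‖ ≤ 1 / 4) (d : EuclideanSpace ℝ (Fin 3)) :
    ⟪d, z⟫_ℝ - ‖d‖ / 4 ≤ ⟪d, EuclideanSpace.single (2 : Fin 3) (1 : ℝ)⟫_ℝ := by
  have h1 : ⟪d, z⟫_ℝ - ⟪d, EuclideanSpace.single (2 : Fin 3) (1 : ℝ)⟫_ℝ =
      ⟪d, z - EuclideanSpace.single (2 : Fin 3) (1 : ℝ)⟫_ℝ := by rw [inner_sub_right]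
  have h2 : ⟪d, z - EuclideanSpace.single (2 : Fin 3) (1 : ℝ)⟫_ℝ ≤
      ‖d‖ * ‖z - EuclideanSpace.single (2 : Fin 3) (1 : ℝ)‖ := real_inner_le_norm _ _
  have h3 : ‖d‖ * ‖z - EuclideanSpace.single (2 : Fin 3) (1 : ℝ)‖ ≤ ‖d‖ * (1 / 4) :=
    mul_le_mul_of_nonneg_left hze (norm_nonneg _)
  linarith

/-- A unit step rising by `≥ 3/8` in a tilted vertical rises by `≥ 1/8` in `e₃`. -/
theorem step_e3_rise_of_tilt {z d : EuclideanSpace ℝ (Fin 3)}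
    (hze : ‖z - EuclideanSpace.single (2 : Fin 3) (1 : ℝ)‖ ≤ 1 / 4) (hd : ‖d‖ = 1)
    (hrise : (3 / 8 : ℝ) ≤ ⟪d, z⟫_ℝ) : (1 / 8 : ℝ) ≤ ⟪d, EuclideanSpace.single (2 : Fin 3) (1 : ℝ)⟫_ℝ := by
  have := inner_e3_ge_of_tilt hze d
  rw [hd] at this
  linarith

/-- A slot that is steep for a tilted vertical rises by `≥ 9/20` in `e₃`. -/
theorem slot_e3_rise_of_tilt {z : EuclideanSpace ℝ (Fin 3)}
    (hze : ‖z - EuclideanSpace.single (2 : Fin 3) (1 : ℝ)‖ ≤ 1 / 4)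
    (A : EuclideanSpace ℝ (Fin 3) ≃ₗᵢ[ℝ] EuclideanSpace ℝ (Fin 3)) {u : EuclideanSpace ℝ (Fin 3)} (hu : u ∈ fccSlots)
    (hsteep : Real.sqrt 2 / 2 ≤ ⟪A u, z⟫_ℝ) : (9 / 20 : ℝ) ≤ ⟪A u, EuclideanSpace.single (2 : Fin 3) (1 : ℝ)⟫_ℝ := by
  have h := inner_e3_ge_of_tilt hze (A u)
  rw [LinearIsometryEquiv.norm_map, norm_eq_one_of_mem_fccSlots hu] at h
  have hs2 : (7 / 10 : ℝ) ≤ Real.sqrt 2 / 2 := by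
    rw [le_div_iff₀ (by norm_num : (0:ℝ) < 2)]
    have : (7 / 10 * 2 : ℝ) = Real.sqrt ((7 / 5) ^ 2) := by rw [Real.sqrt_sq (by norm_num)]; norm_num
    rw [this]; exact Real.sqrt_le_sqrt (by norm_num)
  linarith

/-- **Cone ⇒ drift.**  If `‖Δ‖ ≤ (8/3)⟪Δ, z⟫` and `‖z − e₃‖ ≤ 1/4` then `0 ≤ ⟪Δ, e₃⟫` and `‖Δ‖ ≤ 8⟪Δ, e₃⟫`. -/
theorem disp_le_of_cone_of_tilt {z Δ : EuclideanSpace ℝ (Fin 3)}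
    (hze : ‖z - EuclideanSpace.single (2 : Fin 3) (1 : ℝ)‖ ≤ 1 / 4) (hcone : ‖Δ‖ ≤ 8 / 3 * ⟪Δ, z⟫_ℝ) :
    0 ≤ ⟪Δ, EuclideanSpace.single (2 : Fin 3) (1 : ℝ)⟫_ℝ ∧ ‖Δ‖ ≤ 8 * ⟪Δ, EuclideanSpace.single (2 : Fin 3) (1 : ℝ)⟫_ℝ := by
  have h := inner_e3_ge_of_tilt hze Δ
  have hn := norm_nonneg Δ
  constructor
  · nlinarith
  · nlinarith

/-! ### `e₃`-monotonicity and drift along a run with a tilted vertical -/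

/-- **Displacement control along a run with a tilted vertical**: from a state satisfying `WalkInv`, after any
number of steps the displacement `Δ` satisfies `0 ≤ ⟪Δ, e₃⟫` and `‖Δ‖ ≤ 8⟪Δ, e₃⟫`. -/
theorem walkRun_disp_le_of_tilt (hX : ∀ p ∈ X, ∀ q ∈ X, p ≠ q → 1 ≤ dist p q)
    {s₀ : EuclideanSpace ℝ (Fin 3)} (hs₀ : s₀ ∈ fccSlots)
    (hcert : ExactOnly 0 (fccSlots.filter fun w => 0 < ⟪w, s₀⟫_ℝ))
    {z : EuclideanSpace ℝ (Fin 3)} (hz : ‖z‖ = 1) (hze : ‖z - EuclideanSpace.single (2 : Fin 3) (1 : ℝ)‖ ≤ 1 / 4)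
    {s : EuclideanSpace ℝ (Fin 3) × List WalkEntry} (hI : WalkInv X z s) (k : ℕ) :
    0 ≤ ⟪(walkRun X z k s).1 - s.1, EuclideanSpace.single (2 : Fin 3) (1 : ℝ)⟫_ℝ ∧
      ‖(walkRun X z k s).1 - s.1‖ ≤ 8 * ⟪(walkRun X z k s).1 - s.1, EuclideanSpace.single (2 : Fin 3) (1 : ℝ)⟫_ℝ :=
  disp_le_of_cone_of_tilt hze (walkRun_spec hX hs₀ hcert hz k s hI).2.1

/-- **`e₃`-heights never decrease along a run with a tilted vertical.** -/
theorem walkRun_height3_mono (hX : ∀ p ∈ X, ∀ q ∈ X, p ≠ q → 1 ≤ dist p q)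
    {s₀ : EuclideanSpace ℝ (Fin 3)} (hs₀ : s₀ ∈ fccSlots)
    (hcert : ExactOnly 0 (fccSlots.filter fun w => 0 < ⟪w, s₀⟫_ℝ))
    {z : EuclideanSpace ℝ (Fin 3)} (hz : ‖z‖ = 1) (hze : ‖z - EuclideanSpace.single (2 : Fin 3) (1 : ℝ)‖ ≤ 1 / 4)
    {s : EuclideanSpace ℝ (Fin 3) × List WalkEntry} (hI : WalkInv X z s) (k : ℕ) :
    (walkRun X z k s).1 2 ≤ (walkRun X z (k + 1) s).1 2 := by
  rw [walkRun_succ']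
  have hIk := (walkRun_spec hX hs₀ hcert hz k s hI).1
  have h0 := (walkRun_disp_le_of_tilt hX hs₀ hcert hz hze hIk 1).1
  rw [inner_sub_left, inner_single_two_one, inner_single_two_one] at h0
  linarith

/-- `e₃`-heights never decrease along a run (any number of further steps). -/
theorem walkRun_height3_mono' (hX : ∀ p ∈ X, ∀ q ∈ X, p ≠ q → 1 ≤ dist p q)
    {s₀ : EuclideanSpace ℝ (Fin 3)} (hs₀ : s₀ ∈ fccSlots)
    (hcert : ExactOnly 0 (fccSlots.filter fun w => 0 < ⟪w, s₀⟫_ℝ))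
    {z : EuclideanSpace ℝ (Fin 3)} (hz : ‖z‖ = 1) (hze : ‖z - EuclideanSpace.single (2 : Fin 3) (1 : ℝ)‖ ≤ 1 / 4)
    {s : EuclideanSpace ℝ (Fin 3) × List WalkEntry} (hI : WalkInv X z s) (k j : ℕ) :
    (walkRun X z k s).1 2 ≤ (walkRun X z (k + j) s).1 2 := by
  induction j with
  | zero => simp
  | succ j IH => exact IH.trans (by rw [← add_assoc]; exact walkRun_height3_mono hX hs₀ hcert hz hze hI (k + j))

/-! ### One grain with a tilted vertical: deep prefix and non-revisiting, window by `e₃`-heights -/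

section GrainTilt

variable (hX : ∀ p ∈ X, ∀ q ∈ X, p ≠ q → 1 ≤ dist p q)
  {s₀ : EuclideanSpace ℝ (Fin 3)} (hs₀ : s₀ ∈ fccSlots)
  (hcert : ExactOnly 0 (fccSlots.filter fun w => 0 < ⟪w, s₀⟫_ℝ))
  {z : EuclideanSpace ℝ (Fin 3)} (hz : ‖z‖ = 1)
  (A : EuclideanSpace ℝ (Fin 3) ≃ₗᵢ[ℝ] EuclideanSpace ℝ (Fin 3)) (t₀ : EuclideanSpace ℝ (Fin 3))
  {u : EuclideanSpace ℝ (Fin 3)} (hu : u ∈ fccSlots) (hsteep : Real.sqrt 2 / 2 ≤ ⟪A u, z⟫_ℝ)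
  (S : Finset (EuclideanSpace ℝ (Fin 3))) {hlo Hd ρs ρ' : ℝ} (hρs : 0 ≤ ρs)
  (hS : ∀ p ∈ S, p ∈ X ∧ p ∈ (fun q => A q + t₀) '' fccStacking 1 (Real.sqrt (2 / 3)) ∧
    hlo ≤ p 2 ∧ p 2 ≤ Hd ∧ p 0 ^ 2 + p 1 ^ 2 ≤ ρs ^ 2)
  (hfullS : ∀ p ∈ S, ∀ w ∈ fccSlots, p + A w ∈ X)
  (hdeep : ∀ p ∈ X, p ∈ (fun q => A q + t₀) '' fccStacking 1 (Real.sqrt (2 / 3)) →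
    hlo ≤ p 2 → p 2 ≤ Hd → Real.sqrt (p 0 ^ 2 + p 1 ^ 2) ≤ ρ' → ∀ w ∈ fccSlots, p + A w ∈ X)
  (hroom : ρs + 3 * (Hd - hlo) ≤ ρ')
  (hconv : ∀ p ∈ S, ∀ i : ℕ, 1 ≤ i → p + ((i : ℕ) : ℝ) • A u ∈ S → p + A u ∈ S)

include hX hs₀ hcert hz hu hsteep hρs hS hfullS hdeep hroom in
/-- **The deep prefix (tilted vertical, `e₃`-window).**  A walker launched from `t′ ∈ S` that is still at
`e₃`-height `≤ Hd` after `k` steps has made `k` FULL steps along `A u` and carries the bottom stack. -/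
theorem walkRun_deep_prefix_tilt (hze : ‖z - EuclideanSpace.single (2 : Fin 3) (1 : ℝ)‖ ≤ 1 / 4)
    {t' : EuclideanSpace ℝ (Fin 3)} (ht' : t' ∈ S) (k : ℕ)
    (hk : (walkRun X z k (t' + A u, [⟨A, u, 0⟩])).1 2 ≤ Hd) :
    walkRun X z k (t' + A u, [⟨A, u, 0⟩]) = (t' + A u + (k : ℝ) • A u, [⟨A, u, 0⟩]) := by
  induction k with
  | zero => simp
  | succ k IH =>
    obtain ⟨ht'X, ht'Λ, ht'lo, -, ht'r⟩ := hS t' ht'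
    have hI₀ : WalkInv X z (t' + A u, [⟨A, u, 0⟩]) := walkInv_start A ht'X (hfullS t' ht') hu hsteep
    have hmono := walkRun_height3_mono hX hs₀ hcert hz hze hI₀ k
    have hk' : (walkRun X z k (t' + A u, [⟨A, u, 0⟩])).1 2 ≤ Hd := hmono.trans hk
    have IH' := IH hk'
    set b : EuclideanSpace ℝ (Fin 3) := t' + A u + (k : ℝ) • A u with hb
    have hbX : b ∈ X := by
      have := (walkRun_spec hX hs₀ hcert hz k _ hI₀).1.1
      rw [IH'] at this; exact this
    -- `b` is a lattice ball in the sealed window: full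
    have hu3 : (9 / 20 : ℝ) ≤ (A u) 2 := by
      have := slot_e3_rise_of_tilt hze A hu hsteep; rwa [inner_single_two_one] at this
    have hb2 : b 2 = t' 2 + ((k : ℝ) + 1) * (A u) 2 := by
      rw [hb]; simp only [PiLp.add_apply, PiLp.smul_apply, smul_eq_mul]; ring
    have hblo : hlo ≤ b 2 := by
      rw [hb2]; nlinarith
    have hbHd : b 2 ≤ Hd := by rw [IH'] at hk'; exact hk'
    have hk1 : ((k : ℝ) + 1) * (A u) 2 ≤ Hd - hlo := by linarith
    have hk2 : (k : ℝ) + 1 ≤ 3 * (Hd - hlo) := by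
      have h0 : 0 ≤ (k : ℝ) + 1 := by positivity
      nlinarith [hk1, hu3, h0]
    have hbΛ : b ∈ (fun q => A q + t₀) '' fccStacking 1 (Real.sqrt (2 / 3)) := by
      obtain ⟨q, hq, hqt⟩ := ht'Λ
      refine ⟨q + ((k + 1 : ℕ) : ℝ) • u, add_natCast_smul_mem_fcc hq (mem_fcc_of_mem_fccSlots hu) (k + 1), ?_⟩
      show A (q + ((k + 1 : ℕ) : ℝ) • u) + t₀ = b
      rw [hb, ← hqt, map_add, LinearIsometryEquiv.map_smul]; push_cast; module
    have hblat : Real.sqrt (b 0 ^ 2 + b 1 ^ 2) ≤ ρ' := by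
      have h1 := sqrt_lateral_add_le t' (A u + (k : ℝ) • A u)
      have e1 : t' + (A u + (k : ℝ) • A u) = b := by rw [hb]; abel
      rw [e1] at h1
      have h2 : ‖A u + (k : ℝ) • A u‖ = (k : ℝ) + 1 := by
        rw [show A u + (k : ℝ) • A u = ((k : ℝ) + 1) • A u by module, norm_smul, LinearIsometryEquiv.norm_map,
          norm_eq_one_of_mem_fccSlots hu, mul_one, Real.norm_eq_abs, abs_of_nonneg (by positivity)]
      have h3 : Real.sqrt (t' 0 ^ 2 + t' 1 ^ 2) ≤ ρs := by
        rw [← Real.sqrt_sq hρs]; exact Real.sqrt_le_sqrt ht'r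
      linarith
    have hfull : ∀ w ∈ fccSlots, b + A w ∈ X := hdeep b hbX hbΛ hblo hbHd hblat
    rw [walkRun_succ', IH', walkRun_succ_of_some X z 0 (walkStep_of_full X z b ⟨A, u, 0⟩ [] hfull), walkRun_zero]
    refine Prod.ext ?_ rfl
    show b + A u = t' + A u + ((k + 1 : ℕ) : ℝ) • A u
    rw [hb]; push_cast; module

include hX hs₀ hcert hz hu hsteep hρs hS hfullS hdeep hroom hconv in
/-- **A walker never visits another top's start state (tilted vertical, `e₃`-window).**  For `t, t′ ∈ S` with
`t′` a top (`t′ + A u ∉ S`): if the walk from `t′ + A u` is at the state `(t + A u, bottom stack)` after `i` steps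
then `t = t′`. -/
theorem walkRun_ne_start_tilt (hze : ‖z - EuclideanSpace.single (2 : Fin 3) (1 : ℝ)‖ ≤ 1 / 4)
    {t t' : EuclideanSpace ℝ (Fin 3)} (ht : t ∈ S) (ht' : t' ∈ S) (htop' : t' + A u ∉ S)
    (i : ℕ) (h : walkRun X z i (t' + A u, [⟨A, u, 0⟩]) = (t + A u, [⟨A, u, 0⟩])) : t = t' := by
  induction i with
  | zero =>
    rw [walkRun_zero] at h
    injection h with h1
    exact (add_right_cancel h1).symm
  | succ i IH =>
    obtain ⟨ht'X, -, -, -, -⟩ := hS t' ht'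
    obtain ⟨-, -, -, htHd, -⟩ := hS t ht
    have hI₀ : WalkInv X z (t' + A u, [⟨A, u, 0⟩]) := walkInv_start A ht'X (hfullS t' ht') hu hsteep
    rw [walkRun_succ'] at h
    obtain ⟨hwI, hwW⟩ := walkRun_valid hX hs₀ hcert hz i hI₀ (stackWF_start z A u)
    rcases hws : walkRun X z i (t' + A u, [⟨A, u, 0⟩]) with ⟨yw, stk⟩
    rw [hws] at h hwI hwW
    cases hstep : walkStep X z (yw, stk) with
    | none =>
      rw [walkRun_succ_of_none X z 0 hstep] at h
      exact IH (hws.trans h)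
    | some v =>
      rw [walkRun_succ_of_some X z 0 hstep, walkRun_zero] at h
      subst h
      obtain ⟨-, hSw, ew, rw', hstk, -⟩ := hwI
      simp only at hstk hSw
      subst hstk
      exfalso
      rcases walkStep_cases hstep with ⟨hfullw, hs⟩ | ⟨n, hcap, ⟨e', rest', hr, hn, hs⟩ | ⟨-, hs⟩⟩
      · -- FULL: `w = (t, bottom)` is on the deep prefix: `t = t′ + (i+1)·A u`
        injection hs with hy hl
        injection hl with he hr
        subst he
        have hyt : t = yw := add_right_cancel hy
        subst hyt
        have hdeepi := walkRun_deep_prefix_tilt hX hs₀ hcert hz A t₀ hu hsteep S hρs hS hfullS hdeep hroom hze ht' i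
          (by rw [hws]; exact htHd)
        rw [hws] at hdeepi
        injection hdeepi with hy' hl'
        have hmem : t' + (((i + 1 : ℕ)) : ℝ) • A u ∈ S := by
          have e : t' + (((i + 1 : ℕ)) : ℝ) • A u = t := by rw [hy']; push_cast; module
          rw [e]; exact ht
        exact htop' (hconv t' ht' (i + 1) (by omega) hmem)
      · -- POP: `t` would be an exact cap of the twin frame, but `t` is full in `A`
        subst hr
        injection hs with hy hl
        injection hl with he hr'
        subst he
        have hyt : t = yw := add_right_cancel hy
        subst hyt
        subst hn
        obtain ⟨hSo, hLi, -⟩ := hSw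
        exact false_of_full_of_pop hX hSo hLi hcap (hfullS _ ht)
      · -- PUSH: the stack would have two levels
        rw [pushMove_eq] at hs
        injection hs with _ hl
        injection hl with _ hl'
        exact List.cons_ne_nil _ _ hl'.symm

include hX hs₀ hcert hz hu hsteep hρs hS hfullS hdeep hroom hconv in
/-- **`top ↦ end state` is injective (tilted vertical, `e₃`-window).**  Two tops of `S` whose walks are in the same
state after `N` steps are equal. -/
theorem walkRun_start_injective_tilt (hze : ‖z - EuclideanSpace.single (2 : Fin 3) (1 : ℝ)‖ ≤ 1 / 4)
    {t t' : EuclideanSpace ℝ (Fin 3)} (ht : t ∈ S) (htop : t + A u ∉ S)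
    (ht' : t' ∈ S) (htop' : t' + A u ∉ S) {N : ℕ}
    (h : walkRun X z N (t + A u, [⟨A, u, 0⟩]) = walkRun X z N (t' + A u, [⟨A, u, 0⟩])) : t = t' := by
  have hI : WalkInv X z (t + A u, [⟨A, u, 0⟩]) := walkInv_start A (hS t ht).1 (hfullS t ht) hu hsteep
  have hI' : WalkInv X z (t' + A u, [⟨A, u, 0⟩]) := walkInv_start A (hS t' ht').1 (hfullS t' ht') hu hsteep
  rcases walkRun_eq_walkRun_orbit hX hs₀ hcert hz N hI (stackWF_start z A u) hI' (stackWF_start z A u) h with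
    ⟨j, hj⟩ | ⟨j, hj⟩
  · exact (walkRun_ne_start_tilt hX hs₀ hcert hz A t₀ hu hsteep S hρs hS hfullS hdeep hroom hconv hze ht' ht htop j
      hj).symm
  · exact walkRun_ne_start_tilt hX hs₀ hcert hz A t₀ hu hsteep S hρs hS hfullS hdeep hroom hconv hze ht ht' htop' j hj

end GrainTilt

end Summit.Ventures.Crystal3D.Theorems

end
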